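import Literature.MathematicalPhysics.QuantumFieldTheory.Balaban1983to89.B9Eq326G1SupRowOfLetters
import Literature.MathematicalPhysics.QuantumFieldTheory.Balaban1983to89.B9Eq347LocalLetterAdjoint

/-!
# `Balaban1983to89.B9Eq326G1SupRowAdjoint` — T. Bałaban, *Propagators for lattice gauge theories in a background field*, Commun. Math. Phys. **99** (1985)
# 389–434 [Balaban1985BackgroundPropagators] (3.25)–(3.27) pp. 394–395, Thm 3.1 (3.42) p. 397, (3.49) p. 399, Thm 3.3 p. 399, with p. 391 *«The adjoints are
# taken with respect to natural L² scalar products»*: **THE LOCAL SUP LETTER (L) OF `G₁ = Δ_a⁻¹`, END-FACING FORM — the right factor `V∘A₀⁻¹ = (A₀⁻¹∘Uu)†`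
# of the Woodbury remainder and the block letters of `Uu`, `V = Uu†` DERIVED from the adjoint structure at HEIGHT-FREE prices (`μ_B∕ω_Y`, `√μ_B∕√ω_Y`:
# `d`, `√d` on the tower's diagonal `c₁ = c₀η^{−d}`), (L)(Uu) read from the covariant-GRADIENT row of `D_UG′` (storey J at the tower), and the row
# constant discharged over the coarse torus `T_m`** — the sequel of `B9Eq326G1SupRowOfLetters` (the abstract Woodbury assembly); together they turn
# beta-an4's INTERFACE REQUEST D4 `exists_local_letter_G1k` (journal `HOME/CLAIMS.log` l.64394) into FOUR named letters + one identity + three adjoint facts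

statement-level skeleton of published theorems with citation tags; proofs where landed; nothing here is a claim about the Yang–Mills mass gap

CITATION HEADER (lean-in-tree rule).  Audit cell `pub-balaban`, sub-cell `t4`, BINDER row NE9; filed by NE9 crux-team LEAF PROVER 05
(`b2b-balaban-t4-ne9-formalise-leaf-05`, gen 87; the storey-J ∕ (K41)–(K60) lineage).  Composed BY NAME, nothing restated: this lineage's
`B9Eq326G1SupRowOfLetters` (`letter_comp`, `local_letter_G1_of_letters`); ne9-leaf-03's `B9Eq347LocalLetterAdjoint.block_decay_of_local` ∕
`opNorm_block_adjoint_block` ∕ `local_adjoint`; `B4Sect5Torus.torusSum_le`.  SUPPLIERS of the displayed letters at the tower (none asserted here):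
(L)(A₀,k⁻¹) — ne9-leaf-03 g78's (EA0S) `B9Eq326LocalPartTowerSupDecay.norm_localInvK_apply_le_decay`; (L)(D_UG′_k) — the NE9 owner t4-ne9-p1 g95's INTENT
`B9Eq342GreenPrimeTowerGradientRow.norm_covDeriv_GpOfUk_le_blockLetter` (this lineage's (K41) engine `B9Eq342GradientRowAssembly` §5 at the tower); the range
letter of `Q̃′_k†` — ne9-leaf-03's `B9Eq319QprimeAdjointLocalLetter` shape; the bond-block decay of `G₁,k` — ne9-leaf-03's (FCLG)
`B9Eq326DeltaABlockDecayTowerDiagonalClosed.exists_block_decay_G1k_diagonal_closed`; (L)(c_k) — `B9Eq349ConjugatedQGGQInvSupRowTower.local_letter_QGGQInvk`;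
the identity — the tower twin of t4-ne9-p1's `B9Eq326WoodburySchur.G1ofU_eq_woodbury`; the adjoint facts `(D*_U)† = D_U` (given `hRS`), `G′† = G′`,
`A₀⁻¹† = A₀⁻¹` — this lineage's `B9Eq326LocalPartGradientRowAdjoint`.  Sources READ first-hand this generation in the held text
(`paper:balaban1985-cmp99-background-propagators`, journal page = PDF page + 388): p. 394 (3.25), p. 395 (3.26)–(3.27), p. 397 Thm 3.1 (3.42), p. 399 (3.49),
Thm 3.3.  NOTHING of print's random-walk proof (pp. 415–434) is reproduced; no constant of print is valued.

WHAT IS PROVED (sorry-free; proof lane — no `def`; [folklore]).  Data as in `B9Eq326G1SupRowOfLetters` §1 (fine bonds `X_B`, `w_B`, `π_B`; unit lattice `Y`,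
`w_Y`; bond block family `P`, point family `r` by their (K1) letters; `A₀⁻¹, G₁, Uu, V, c` continuous linear maps between the weighted carriers).
* §1 **`block_letter_U_of_local`** — (L)(Uu; B_U, κ) ⟹ `‖P_z∘Uu∘r_y‖ ≤ B_U·√μ_B∕√ω_Y·e^{−κδ(y,z)}` (`block_decay_of_local`); **`adjoint_block_eq_self`** — a block
  family given by indicators is self-adjoint (cf. ne9-leaf-01's `B9Eq349KWAssembly.adjoint_eq_self_of_pointwise`, this lineage's
  `B9Eq326LocalPartDivergenceBlockLetterClosed.adjoint_eq_self_of_blockwise` at `𝕜 = ℂ`); **`block_letter_V_of_adjoint`** — `Uu† = V` ⟹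
  `‖r_y∘V∘P_z‖ ≤ C_U e^{−κδ(z,y)}` from `Uu`'s block letter; **`letter_VA_of_adjoint`** — (L)(A₀⁻¹; B_A, κ), (L)(Uu; B_U, κ), `A₀⁻¹† = A₀⁻¹`, `Uu† = V`,
  `0 ≤ κ′ ≤ κ`, `Σ_u e^{−(κ−κ′)δ(w,u)} ≤ S′` ⟹ **(L)(V∘A₀⁻¹; B_U·B_A·S′·(μ_B∕ω_Y), κ′)** — `letter_comp` then `local_adjoint` on the points → bonds operator
  `A₀⁻¹∘Uu`: the RIGHT factor of the Woodbury remainder is read at COARSE points, so the duality price is (bond-block mass)∕(least point weight) = `d` on the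
  diagonal, NOT the `(L^{n+1})^d` of a bonds → bonds transposition (`B9Eq347LocalLetterAdjoint.local_adjoint_sites`' `L^d` at side `L^{n+1}`);
  **`local_letter_G1_of_adjoint`** — THE END-FACING FORM: displayed = the Woodbury identity `hW`, `Uu† = V`, `A₀⁻¹† = A₀⁻¹`, (L)(A₀⁻¹; B_A, κ), (L)(Uu; B_U, κ),
  (L)(c; B_c, κ), the bond-block decay `‖P_{z′}∘G₁∘P_z‖ ≤ A₁e^{−κδ}`, `ω_Y ≤ w_Y ≤ μ_Y`, the bond-block mass `μ_B`, `0 ≤ κ′ < κ`, ONE row constant `S` at the gap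
  `(κ−κ′)∕2`; conclusion **(L)(G₁; B⋆, κ′)**, `B⋆ = B_A + B_A·B_U·B_c·B_V·S³·(1 + B_c·B_X·S²)`, `B_V = B_U·B_A·S·(μ_B∕ω_Y)`,
  `B_X = (B_U√μ_B∕√ω_Y)·A₁·(B_U√μ_B∕√ω_Y)·S²·(√μ_Y∕√ω_Y)`.
* §2 **`letter_U_of_gradientRow`** — (L)(Uu; B_D·M_Q, κ) for `Uu = (D_UG′)∘Q̃′†` from the covariant-gradient row (L)(D_UG′; B_D, κ) on block-supported site data
  and the range ∕ size letter of `Q̃′†` (a point source at `v` ↦ a site field supported in the block `v`, `≤ M_Q·sup`): no rate loss, no row constant.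
* §3 **`local_letter_G1_torus`** — `Y = T_m`, `δ = d_m`, `S = K_d((κ−κ′)∕2)` by `torusSum_le` (`1 ≤ m_i`), VOLUME-FREE: beta-an4's requested shape
  «`∀ v f F, (f supported over the unit block v, ‖f(b)‖ ≤ F) → ‖(G₁f)(b)‖ ≤ B·e^{−δ·d_m(π_B b, v)}·F`» BEFORE the `∃ (α₁, B, δ)`-closing over print's window;
  **`local_letter_G1_torus_const`** — constant weights `w_Y ≡ c₁`, bond-block mass `≤ d_B·c₁`: the weights CANCEL (`μ_B∕ω_Y = d_B`, `√μ_B∕√ω_Y = √d_B`,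
  `√μ_Y∕√ω_Y = 1`) and `B⋆` is a function of the letters' constants, `d_B` and `K_d((κ−κ′)∕2)` only — the form in which the END picks `B` BEFORE the height.
HONEST SCOPE.  Algebra over DISPLAYED letters; the four letters, the identity at the tower (`G1k`, `GpOfUk`, `Q̃′_k`, `c_k`) and the three adjoint facts are
the suppliers' and the instantiator's; `B⋆` is crude; nothing of [B9] Thm 3.1 ∕ 3.3 ∕ 3.11 is asserted, valued or discharged.  NOT NE9 (cell pub-balaban: NE9
NOT PRINTED ∕ NOT PROVED; «NE9 ⇐ the named binders»; row WALLED ON A MODEL (O-NE9-1; #5 UNRULED); spine PROVED 0∕9; rung (B)+1 on a finite T⁴ — NOT infinite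
volume, NOT mass gap, NOT BetaPertH, NOT Clay; HONEST DEPENDENCY: continuum YM on T⁴ ⇐ BetaPertH ∧ nine spine estimates (0/9 proved); BetaPertH ⇐ (D1) ∧
(D4) ∧ CAP+tail; G-an2-4 gates asym, D1 and NE2/3/4).  NEW file importing this lineage's `B9Eq326G1SupRowOfLetters` (filed this generation; lands when that
module's hub olean exists) and ne9-leaf-03's `B9Eq347LocalLetterAdjoint` (built); nothing modified.  Net new unproved facts: 0.
-/

noncomputable section

set_option autoImplicit false

open scoped BigOperators InnerProductSpace

namespace Literature.MathematicalPhysics.QuantumFieldTheory.Balaban1983to89.B9Eq326G1SupRowAdjoint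

open B9Eq311L2Pairing (WL2)
open B4Sect5Torus (TSite tdist tdist_triangle tdist_nonneg tdist_symm torusSum_le)
open B4Sect5Proof (latticeConst latticeConst_nonneg)
open B9Eq347LocalLetterAdjoint (block_decay_of_local opNorm_block_adjoint_block local_adjoint)
open B9Eq326G1SupRowOfLetters (letter_comp local_letter_G1_of_letters)

/-! ## §1 The block letters and the right factor `V∘A₀⁻¹` from the adjoint (`V = Uu†`, `A₀⁻¹` self-adjoint): prices `√(μ_B∕ω_Y)` and `μ_B∕ω_Y` -/

section Adjoint

variable {𝕜 : Type*} [RCLike 𝕜] {XB Y : Type*} [Fintype XB] [Fintype Y] [DecidableEq Y] [Nonempty XB] [Nonempty Y]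
  {wB : XB → ℝ} {wY : Y → ℝ} [Fact (∀ x, 0 < wB x)] [Fact (∀ y, 0 < wY y)]
  {V : Type*} [NormedAddCommGroup V] [InnerProductSpace 𝕜 V]
  (πB : XB → Y) (δ : Y → Y → ℝ) (hδ0 : ∀ u v, 0 ≤ δ u v) (hδt : ∀ u y v, δ u v ≤ δ u y + δ y v) (hδs : ∀ u v, δ u v = δ v u)
  {P : Y → WL2 𝕜 wB V →L[𝕜] WL2 𝕜 wB V}
  (hP : ∀ (y : Y) (f : WL2 𝕜 wB V) (x : XB), WL2.equiv 𝕜 wB V (P y f) x = if πB x = y then WL2.equiv 𝕜 wB V f x else 0)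
  {rY : Y → WL2 𝕜 wY V →L[𝕜] WL2 𝕜 wY V}
  (hrY : ∀ (y : Y) (g : WL2 𝕜 wY V) (u : Y), WL2.equiv 𝕜 wY V (rY y g) u = if u = y then WL2.equiv 𝕜 wY V g u else 0)
  (A G : WL2 𝕜 wB V →L[𝕜] WL2 𝕜 wB V) (Uop : WL2 𝕜 wY V →L[𝕜] WL2 𝕜 wB V) (Vop : WL2 𝕜 wB V →L[𝕜] WL2 𝕜 wY V)
  (C : WL2 𝕜 wY V →L[𝕜] WL2 𝕜 wY V)

omit [Nonempty XB] [Nonempty Y] in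
include hδs hP hrY in
/-- **THE BLOCK LETTER OF `Uu` FROM ITS LOCAL LETTER** (`B9Eq347LocalLetterAdjoint.block_decay_of_local`, source = the unit lattice with weights
`≥ ω_Y`, output bond blocks of weighted mass `≤ μ_B`): (L)(Uu; B_U, κ) ⟹ `‖P_z∘Uu∘r_y‖ ≤ B_U·√μ_B∕√ω_Y·e^{−κδ(y,z)}` (`δ` symmetric). [folklore]
[cite: Balaban1985BackgroundPropagators, Thm 3.1 (3.42) p.397, (3.49) p.399, (3.11) p.392] -/
theorem block_letter_U_of_local {BU κ ωY μB : ℝ} (hBU : 0 ≤ BU) (hωY : 0 < ωY) (hwY : ∀ y, ωY ≤ wY y)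
    (hμB : ∀ u, ∑ x, (if πB x = u then wB x else 0) ≤ μB)
    (hU : ∀ (v : Y) (g : WL2 𝕜 wY V) (F : ℝ), (∀ u, id u ≠ v → WL2.equiv 𝕜 wY V g u = 0) → (∀ u, ‖WL2.equiv 𝕜 wY V g u‖ ≤ F) →
      ∀ x, ‖WL2.equiv 𝕜 wB V (Uop g) x‖ ≤ BU * Real.exp (-(κ * δ (πB x) v)) * F)
    (y z : Y) : ‖P z ∘L Uop ∘L rY y‖ ≤ BU * Real.sqrt μB / Real.sqrt ωY * Real.exp (-(κ * δ y z)) := by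
  have h := block_decay_of_local (π := id) (π' := πB) hrY hP Uop δ hBU hωY hwY hμB hU z y
  rw [hδs y z]; exact h

omit [Fintype Y] [Nonempty XB] [Nonempty Y] [DecidableEq Y] in
/-- **A BLOCK FAMILY GIVEN BY INDICATORS IS SELF-ADJOINT** in the weighted `L²` space (`⟪P_yf, g⟫ = Σ_x w(x)⟪[πx = y]f(x), g(x)⟩ = ⟪f, P_yg⟫`; cf.
ne9-leaf-01's `B9Eq349KWAssembly.adjoint_eq_self_of_pointwise`, this lineage's `B9Eq326LocalPartDivergenceBlockLetterClosed.adjoint_eq_self_of_blockwise`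
at `𝕜 = ℂ`). [folklore] [cite: Balaban1985BackgroundPropagators, p.391 «The adjoints are taken with respect to natural L² scalar products», (3.49) p.399] -/
theorem adjoint_block_eq_self [FiniteDimensional 𝕜 V] {X : Type*} [Fintype X] {w : X → ℝ} [Fact (∀ x, 0 < w x)] {π : X → Y} [DecidableEq Y]
    (Pf : WL2 𝕜 w V →L[𝕜] WL2 𝕜 w V) (y : Y)
    (hPf : ∀ (f : WL2 𝕜 w V) (x : X), WL2.equiv 𝕜 w V (Pf f) x = if π x = y then WL2.equiv 𝕜 w V f x else 0) :
    ContinuousLinearMap.adjoint Pf = Pf := by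
  symm
  rw [ContinuousLinearMap.eq_adjoint_iff]
  intro f g
  rw [WL2.inner_def, WL2.inner_def]
  refine Finset.sum_congr rfl fun x _ => ?_
  rw [hPf f x, hPf g x]
  split_ifs <;> simp

variable [FiniteDimensional 𝕜 V]

omit [Nonempty XB] [Nonempty Y] in
include hδs hP hrY in
/-- **THE BLOCK LETTER OF `V = Uu†`** (`B9Eq347LocalLetterAdjoint.opNorm_block_adjoint_block`: `‖r_y∘Uu†∘P_z‖ = ‖P_z∘Uu∘r_y‖`, the families self-adjoint
by `adjoint_block_eq_self`): `‖P_z∘Uu∘r_y‖ ≤ C_Ue^{−κδ(y,z)}` ⟹ `‖r_y∘V∘P_z‖ ≤ C_Ue^{−κδ(z,y)}`. [folklore]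
[cite: Balaban1985BackgroundPropagators, p.391, (3.25) p.394, (3.49) p.399] -/
theorem block_letter_V_of_adjoint (hVadj : ContinuousLinearMap.adjoint Uop = Vop) {CU κ : ℝ}
    (hUblk : ∀ y z, ‖P z ∘L Uop ∘L rY y‖ ≤ CU * Real.exp (-(κ * δ y z))) (z y : Y) :
    ‖rY y ∘L Vop ∘L P z‖ ≤ CU * Real.exp (-(κ * δ z y)) := by
  have hPadj : ∀ u, ContinuousLinearMap.adjoint (P u) = P u := fun u => adjoint_block_eq_self (P u) u (fun f x => hP u f x)
  have hrYadj : ∀ u, ContinuousLinearMap.adjoint (rY u) = rY u := fun u => adjoint_block_eq_self (π := id) (rY u) u (fun g x => hrY u g x)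
  rw [← hVadj, opNorm_block_adjoint_block Uop hrYadj hPadj z y, hδs z y]
  exact hUblk y z

include hδ0 hδt hδs hP hrY in
/-- **THE RIGHT FACTOR `V∘A₀⁻¹ = (A₀⁻¹∘Uu)†` CARRIES (L) AT THE HEIGHT-FREE PRICE `μ_B∕ω_Y`** (`B9Eq347LocalLetterAdjoint.local_adjoint` on the points → bonds
operator `A₀⁻¹∘Uu`, whose output blocks are BOND blocks of weighted mass `≤ μ_B` and whose source weights are `≥ ω_Y`; on the diagonal `c₁ = c₀η^{−d}` of
the tower `μ_B∕ω_Y = d`): (L)(A₀⁻¹; B_A, κ), (L)(Uu; B_U, κ), `A₀⁻¹† = A₀⁻¹`, `Uu† = V`, `0 ≤ κ′ ≤ κ`, `Σ_u e^{−(κ−κ′)δ(w,u)} ≤ S′` ⟹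
(L)(V∘A₀⁻¹; B_U·B_A·S′·μ_B∕ω_Y, κ′). [folklore] [cite: Balaban1985BackgroundPropagators, p.391, (3.25)–(3.26) pp.394–395, Thm 3.1 (3.42) p.397, (3.49) p.399] -/
theorem letter_VA_of_adjoint (hVadj : ContinuousLinearMap.adjoint Uop = Vop) (hAadj : ContinuousLinearMap.adjoint A = A)
    {BA BU κ κ' S' ωY μB : ℝ} (hBA : 0 ≤ BA) (hBU : 0 ≤ BU) (hκ' : 0 ≤ κ') (hκ : κ' ≤ κ) (hωY : 0 < ωY) (hwY : ∀ y, ωY ≤ wY y)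
    (hμB : ∀ u, ∑ x, (if πB x = u then wB x else 0) ≤ μB)
    (hA : ∀ (v : Y) (f : WL2 𝕜 wB V) (F : ℝ), (∀ x, πB x ≠ v → WL2.equiv 𝕜 wB V f x = 0) → (∀ x, ‖WL2.equiv 𝕜 wB V f x‖ ≤ F) →
      ∀ x, ‖WL2.equiv 𝕜 wB V (A f) x‖ ≤ BA * Real.exp (-(κ * δ (πB x) v)) * F)
    (hU : ∀ (v : Y) (g : WL2 𝕜 wY V) (F : ℝ), (∀ u, id u ≠ v → WL2.equiv 𝕜 wY V g u = 0) → (∀ u, ‖WL2.equiv 𝕜 wY V g u‖ ≤ F) →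
      ∀ x, ‖WL2.equiv 𝕜 wB V (Uop g) x‖ ≤ BU * Real.exp (-(κ * δ (πB x) v)) * F)
    (hS' : ∀ w, ∑ u, Real.exp (-((κ - κ') * δ w u)) ≤ S')
    (v : Y) (f : WL2 𝕜 wB V) (F : ℝ) (hfv : ∀ x, πB x ≠ v → WL2.equiv 𝕜 wB V f x = 0) (hfF : ∀ x, ‖WL2.equiv 𝕜 wB V f x‖ ≤ F) (u : Y) :
    ‖WL2.equiv 𝕜 wY V ((Vop ∘L A) f) u‖ ≤ BU * BA * S' * (μB / ωY) * Real.exp (-(κ' * δ (id u) v)) * F := by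
  have hPadj : ∀ u, ContinuousLinearMap.adjoint (P u) = P u := fun u => adjoint_block_eq_self (P u) u (fun f x => hP u f x)
  have hrYadj : ∀ u, ContinuousLinearMap.adjoint (rY u) = rY u := fun u => adjoint_block_eq_self (π := id) (rY u) u (fun g x => hrY u g x)
  have hS0 : 0 ≤ S' := (Finset.sum_nonneg fun u _ => Real.exp_nonneg _).trans (hS' v)
  -- (L)(A₀⁻¹∘Uu; B_U·B_A·S′, κ′): points → bonds
  have hAU := letter_comp δ id πB πB Uop A hδ0 hδt hBU hBA hκ' hκ hU hA hS'
  -- its adjoint is `V∘A₀⁻¹`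
  have hadj : ContinuousLinearMap.adjoint (A ∘L Uop) = Vop ∘L A := by rw [ContinuousLinearMap.adjoint_comp, hVadj, hAadj]
  have hμB0 : 0 ≤ μB := (Finset.sum_nonneg fun x _ => by
    have hw : ∀ x, 0 < wB x := Fact.out
    by_cases hx : πB x = v
    · rw [if_pos hx]; exact (hw x).le
    · rw [if_neg hx]).trans (hμB v)
  have h := local_adjoint (π := id) (π' := πB) hrY hP (A ∘L Uop) δ hδs hrYadj hPadj (by positivity) hωY hwY hμB hAU v f F hfv hfF u
  rw [hadj] at h
  calc _ ≤ BU * BA * S' * Real.sqrt μB / Real.sqrt ωY * Real.sqrt μB / Real.sqrt ωY * Real.exp (-(κ' * δ (id u) v)) * F := h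
    _ = BU * BA * S' * (μB / ωY) * Real.exp (-(κ' * δ (id u) v)) * F := by
        have hsq : Real.sqrt μB / Real.sqrt ωY * Real.sqrt μB / Real.sqrt ωY = μB / ωY := by
          rw [div_mul_eq_mul_div, ← pow_two, div_div, ← pow_two, Real.sq_sqrt hμB0, Real.sq_sqrt hωY.le]
        calc BU * BA * S' * Real.sqrt μB / Real.sqrt ωY * Real.sqrt μB / Real.sqrt ωY * Real.exp (-(κ' * δ (id u) v)) * F
            = BU * BA * S' * (Real.sqrt μB / Real.sqrt ωY * Real.sqrt μB / Real.sqrt ωY) * Real.exp (-(κ' * δ (id u) v)) * F := by ring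
          _ = _ := by rw [hsq]

include hδ0 hδt hδs hP hrY in
/-- **THE LETTER (L) OF `G₁` — END-FACING FORM** (`local_letter_G1_of_letters` with the right factor and the two block letters of `Uu`∕`V` DERIVED from
the adjoint structure `Uu† = V`, `A₀⁻¹† = A₀⁻¹` by §1; the assembly is `B9Eq326G1SupRowOfLetters.local_letter_G1_of_letters`).  DISPLAYED: the Woodbury identity `hW`; (L)(A₀⁻¹; B_A, κ) (supplier at the tower: ne9-leaf-03's
(EA0S) `B9Eq326LocalPartTowerSupDecay.norm_localInvK_apply_le_decay`); (L)(Uu; B_U, κ) for `Uu = D_UG′Q̃′†` on unit-lattice point sources (supplier: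
the OWNER t4-ne9-p1's `B9Eq342GreenPrimeTowerGradientRow` ∘ the range letter of `Q̃′†`, §2 below); the bond-block decay `‖P_{z′}∘G₁∘P_z‖ ≤ A₁e^{−κδ}`
(supplier: ne9-leaf-03's (FCLG) `B9Eq326DeltaABlockDecayTowerDiagonalClosed`); (L)(c; B_c, κ) for `c = (Q̃′G′²Q̃′†)⁻¹` (supplier:
`B9Eq349ConjugatedQGGQInvSupRowTower.local_letter_QGGQInvk`); the weights' floor∕ceiling `ω_Y ≤ w_Y ≤ μ_Y` and the bond-block mass `μ_B`; `0 ≤ κ′ < κ`; ONE row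
constant `S` at the gap `(κ−κ′)∕2`.  CONCLUSION: (L)(G₁; B⋆, κ′) with
`B⋆ = B_A + B_A·B_U·B_c·B_V·S³·(1 + B_c·B_X·S²)`, `B_V = B_U·B_A·S·(μ_B∕ω_Y)`, `B_X = (B_U√μ_B∕√ω_Y)·A₁·(B_U√μ_B∕√ω_Y)·S²·(√μ_Y∕√ω_Y)` — on the tower's
diagonal (`w_B ≡ c₀`, `w_Y ≡ c₁ = c₀η^{−d}`, `d` bonds per site) every price is `d`, `√d` or `1`: HEIGHT-FREE. [folklore]
[cite: Balaban1985BackgroundPropagators, (3.25)–(3.26) pp.394–395, Thm 3.1 (3.42) p.397, (3.49) p.399, Thm 3.11 p.416, p.415 «random walk expansion»] -/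
theorem local_letter_G1_of_adjoint
    (hW : ∀ f, G f = A f + A (Uop ((C + C ∘L Vop ∘L G ∘L Uop ∘L C) (Vop (A f)))))
    (hVadj : ContinuousLinearMap.adjoint Uop = Vop) (hAadj : ContinuousLinearMap.adjoint A = A)
    {BA BU Bc A₁ κ κ' S ωY μY μB : ℝ} (hBA : 0 ≤ BA) (hBU : 0 ≤ BU) (hBc : 0 ≤ Bc) (hA₁ : 0 ≤ A₁) (hκ' : 0 ≤ κ') (hκ : κ' < κ)
    (hωY : 0 < ωY) (hwY : ∀ y, ωY ≤ wY y) (hwYμ : ∀ y, wY y ≤ μY) (hμB : ∀ u, ∑ x, (if πB x = u then wB x else 0) ≤ μB)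
    (hA : ∀ (v : Y) (f : WL2 𝕜 wB V) (F : ℝ), (∀ x, πB x ≠ v → WL2.equiv 𝕜 wB V f x = 0) → (∀ x, ‖WL2.equiv 𝕜 wB V f x‖ ≤ F) →
      ∀ x, ‖WL2.equiv 𝕜 wB V (A f) x‖ ≤ BA * Real.exp (-(κ * δ (πB x) v)) * F)
    (hU : ∀ (v : Y) (g : WL2 𝕜 wY V) (F : ℝ), (∀ u, id u ≠ v → WL2.equiv 𝕜 wY V g u = 0) → (∀ u, ‖WL2.equiv 𝕜 wY V g u‖ ≤ F) →
      ∀ x, ‖WL2.equiv 𝕜 wB V (Uop g) x‖ ≤ BU * Real.exp (-(κ * δ (πB x) v)) * F)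
    (hC : ∀ (v : Y) (g : WL2 𝕜 wY V) (F : ℝ), (∀ u, id u ≠ v → WL2.equiv 𝕜 wY V g u = 0) → (∀ u, ‖WL2.equiv 𝕜 wY V g u‖ ≤ F) →
      ∀ u, ‖WL2.equiv 𝕜 wY V (C g) u‖ ≤ Bc * Real.exp (-(κ * δ (id u) v)) * F)
    (hGblk : ∀ z z', ‖P z' ∘L G ∘L P z‖ ≤ A₁ * Real.exp (-(κ * δ z z')))
    (hS : ∀ w, ∑ u, Real.exp (-((κ - κ') / 2 * δ w u)) ≤ S)
    (v : Y) (f : WL2 𝕜 wB V) (F : ℝ) (hfv : ∀ x, πB x ≠ v → WL2.equiv 𝕜 wB V f x = 0) (hfF : ∀ x, ‖WL2.equiv 𝕜 wB V f x‖ ≤ F)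
    (b : XB) :
    ‖WL2.equiv 𝕜 wB V (G f) b‖ ≤
      (BA + BA * BU * Bc * (BU * BA * S * (μB / ωY)) * S ^ 3 *
        (1 + Bc * ((BU * Real.sqrt μB / Real.sqrt ωY) * A₁ * (BU * Real.sqrt μB / Real.sqrt ωY) * S ^ 2 * (Real.sqrt μY / Real.sqrt ωY)) *
          S ^ 2)) * Real.exp (-(κ' * δ (πB b) v)) * F := by
  have hS' : ∀ w, ∑ u, Real.exp (-((κ - κ') * δ w u)) ≤ S := fun w =>
    (Finset.sum_le_sum fun u _ => Real.exp_le_exp.2 (by nlinarith [hδ0 w u])).trans (hS w)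
  have hS0 : 0 ≤ S := (Finset.sum_nonneg fun u _ => Real.exp_nonneg _).trans (hS v)
  have hμB0 : 0 ≤ μB := (Finset.sum_nonneg fun x _ => by
    have hw : ∀ x, 0 < wB x := Fact.out
    by_cases hx : πB x = v
    · rw [if_pos hx]; exact (hw x).le
    · rw [if_neg hx]).trans (hμB v)
  -- the derived letters
  have hUblk := block_letter_U_of_local πB δ hδs hP hrY Uop hBU hωY hwY hμB hU
  have hVblk := block_letter_V_of_adjoint πB δ hδs hP hrY Uop Vop hVadj hUblk
  have hVA := letter_VA_of_adjoint πB δ hδ0 hδt hδs hP hrY A Uop Vop hVadj hAadj hBA hBU hκ' hκ.le hωY hwY hμB hA hU hS'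
  exact local_letter_G1_of_letters πB δ hδ0 hδt hδs hP hrY A G Uop Vop C hW hBA hBU (by positivity) hBc hA₁ (by positivity) (by positivity) hκ' hκ
    hωY hwY hwYμ hA hU hVA hC hGblk hUblk hVblk hS v f F hfv hfF b

end Adjoint

/-! ## §2 The letter of `Uu = (D_UG′)∘Q̃′†` from the covariant-gradient row and the range letter of `Q̃′†` -/

section GradientRow

variable {𝕜 : Type*} [RCLike 𝕜] {XB XS Y : Type*} [Fintype XB] [Fintype XS] [Fintype Y]
  {wB : XB → ℝ} {wS : XS → ℝ} {wY : Y → ℝ} [Fact (∀ x, 0 < wB x)] [Fact (∀ x, 0 < wS x)] [Fact (∀ y, 0 < wY y)]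
  {V : Type*} [NormedAddCommGroup V] [InnerProductSpace 𝕜 V]
  (πB : XB → Y) (πS : XS → Y) (δ : Y → Y → ℝ)

/-- **(L)(Uu) FROM THE GRADIENT ROW**: if `D_UG′` (sites → bonds) carries (L)(D_UG′; B_D, κ) on block-supported site data (the OWNER's
`B9Eq342GreenPrimeTowerGradientRow.norm_covDeriv_GpOfUk_le_blockLetter` shape) and `Q̃′†` maps a point source at `v` to a site field supported in the
block `v` and bounded by `M_Q·sup` (ne9-leaf-03's `B9Eq319QprimeAdjointLocalLetter` shape), then `Uu = (D_UG′)∘Q̃′†` carries (L)(Uu; B_D·M_Q, κ) — no rate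
loss, no row constant (the middle field lives in ONE block). [folklore] [cite: Balaban1985BackgroundPropagators, (3.23) p.394, (3.25) p.394, Thm 3.1 (3.42) p.397] -/
theorem letter_U_of_gradientRow (DG : WL2 𝕜 wS V →L[𝕜] WL2 𝕜 wB V) (Qd : WL2 𝕜 wY V →L[𝕜] WL2 𝕜 wS V) {BD MQ κ : ℝ}
    (hDG : ∀ (v : Y) (g : WL2 𝕜 wS V) (F : ℝ), (∀ x, πS x ≠ v → WL2.equiv 𝕜 wS V g x = 0) → (∀ x, ‖WL2.equiv 𝕜 wS V g x‖ ≤ F) →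
      ∀ x, ‖WL2.equiv 𝕜 wB V (DG g) x‖ ≤ BD * Real.exp (-(κ * δ (πB x) v)) * F)
    (hQsupp : ∀ (v : Y) (z : WL2 𝕜 wY V), (∀ u, id u ≠ v → WL2.equiv 𝕜 wY V z u = 0) → ∀ x, πS x ≠ v → WL2.equiv 𝕜 wS V (Qd z) x = 0)
    (hQbd : ∀ (z : WL2 𝕜 wY V) (F : ℝ), (∀ u, ‖WL2.equiv 𝕜 wY V z u‖ ≤ F) → ∀ x, ‖WL2.equiv 𝕜 wS V (Qd z) x‖ ≤ MQ * F)
    (v : Y) (z : WL2 𝕜 wY V) (F : ℝ) (hzv : ∀ u, id u ≠ v → WL2.equiv 𝕜 wY V z u = 0) (hzF : ∀ u, ‖WL2.equiv 𝕜 wY V z u‖ ≤ F) (x : XB) :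
    ‖WL2.equiv 𝕜 wB V ((DG ∘L Qd) z) x‖ ≤ BD * MQ * Real.exp (-(κ * δ (πB x) v)) * F := by
  have h := hDG v (Qd z) (MQ * F) (hQsupp v z hzv) (hQbd z F hzF) x
  calc _ ≤ BD * Real.exp (-(κ * δ (πB x) v)) * (MQ * F) := h
    _ = BD * MQ * Real.exp (-(κ * δ (πB x) v)) * F := by ring

end GradientRow

/-! ## §3 Carriers over the coarse torus `T_m`: the row constant discharged by `torusSum_le` (volume-free) -/

section Lattice

variable {𝕜 : Type*} [RCLike 𝕜] {XB : Type*} [Fintype XB] [Nonempty XB] {d : ℕ} {m : Fin d → ℕ}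
  {wB : XB → ℝ} {wY : TSite d m → ℝ} [Fact (∀ x, 0 < wB x)] [Fact (∀ y, 0 < wY y)]
  {V : Type*} [NormedAddCommGroup V] [InnerProductSpace 𝕜 V] [FiniteDimensional 𝕜 V]
  (πB : XB → TSite d m)
  {P : TSite d m → WL2 𝕜 wB V →L[𝕜] WL2 𝕜 wB V}
  (hP : ∀ (y : TSite d m) (f : WL2 𝕜 wB V) (x : XB), WL2.equiv 𝕜 wB V (P y f) x = if πB x = y then WL2.equiv 𝕜 wB V f x else 0)
  {rY : TSite d m → WL2 𝕜 wY V →L[𝕜] WL2 𝕜 wY V}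
  (hrY : ∀ (y : TSite d m) (g : WL2 𝕜 wY V) (u : TSite d m), WL2.equiv 𝕜 wY V (rY y g) u = if u = y then WL2.equiv 𝕜 wY V g u else 0)
  (A G : WL2 𝕜 wB V →L[𝕜] WL2 𝕜 wB V) (Uop : WL2 𝕜 wY V →L[𝕜] WL2 𝕜 wB V) (Vop : WL2 𝕜 wB V →L[𝕜] WL2 𝕜 wY V)
  (C : WL2 𝕜 wY V →L[𝕜] WL2 𝕜 wY V)

include hP hrY in
/-- **THE LETTER (L) OF `G₁` OVER THE COARSE TORUS `T_m`** (`δ = d_m`, blocks = the unit lattice; `local_letter_G1_of_adjoint` with `S := K_d((κ−κ′)∕2)` by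
`B4Sect5Torus.torusSum_le`, VOLUME-FREE; `1 ≤ m_i`): the Woodbury identity, `Uu† = V`, `A₀⁻¹† = A₀⁻¹`, (L)(A₀⁻¹; B_A, κ), (L)(Uu; B_U, κ), (L)(c; B_c, κ), the
bond-block decay `(A₁, κ)` of `G₁`, weights `ω_Y ≤ w_Y ≤ μ_Y`, bond-block mass `μ_B`, `0 ≤ κ′ < κ` ⟹ for every unit site `v`, every bond field `f` supported
over `π_B⁻¹(v)` with `‖f(b)‖ ≤ F`, every bond `b`: `‖(G₁f)(b)‖ ≤ B⋆·e^{−κ′d_m(π_B b, v)}·F`, `B⋆` as in §1 at `S = K_d((κ−κ′)∕2)` — beta-an4's requested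
shape for `G₁,k` (`exists_local_letter_G1k`) BEFORE the `∃ (α₁, B, δ)`-closing over print's window (`B⋆` as in `local_letter_G1_of_adjoint` at
`S = K_d((κ−κ′)∕2)`). [folklore] [cite: Balaban1985BackgroundPropagators, (3.25)–(3.26) pp.394–395, Thm 3.1 (3.42) p.397, (3.49) p.399, Thm 3.11 p.416]
[cite: Balaban1984PropagatorsII, Lemma 2.1 (2.61) p.234] -/
theorem local_letter_G1_torus (hm : ∀ i, 1 ≤ m i)
    (hW : ∀ f, G f = A f + A (Uop ((C + C ∘L Vop ∘L G ∘L Uop ∘L C) (Vop (A f)))))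
    (hVadj : ContinuousLinearMap.adjoint Uop = Vop) (hAadj : ContinuousLinearMap.adjoint A = A)
    {BA BU Bc A₁ κ κ' ωY μY μB : ℝ} (hBA : 0 ≤ BA) (hBU : 0 ≤ BU) (hBc : 0 ≤ Bc) (hA₁ : 0 ≤ A₁) (hκ' : 0 ≤ κ') (hκ : κ' < κ)
    (hωY : 0 < ωY) (hwY : ∀ y, ωY ≤ wY y) (hwYμ : ∀ y, wY y ≤ μY) (hμB : ∀ u, ∑ x, (if πB x = u then wB x else 0) ≤ μB)
    (hA : ∀ (v : TSite d m) (f : WL2 𝕜 wB V) (F : ℝ), (∀ x, πB x ≠ v → WL2.equiv 𝕜 wB V f x = 0) → (∀ x, ‖WL2.equiv 𝕜 wB V f x‖ ≤ F) →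
      ∀ x, ‖WL2.equiv 𝕜 wB V (A f) x‖ ≤ BA * Real.exp (-(κ * tdist m (πB x) v)) * F)
    (hU : ∀ (v : TSite d m) (g : WL2 𝕜 wY V) (F : ℝ), (∀ u, id u ≠ v → WL2.equiv 𝕜 wY V g u = 0) → (∀ u, ‖WL2.equiv 𝕜 wY V g u‖ ≤ F) →
      ∀ x, ‖WL2.equiv 𝕜 wB V (Uop g) x‖ ≤ BU * Real.exp (-(κ * tdist m (πB x) v)) * F)
    (hC : ∀ (v : TSite d m) (g : WL2 𝕜 wY V) (F : ℝ), (∀ u, id u ≠ v → WL2.equiv 𝕜 wY V g u = 0) → (∀ u, ‖WL2.equiv 𝕜 wY V g u‖ ≤ F) →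
      ∀ u, ‖WL2.equiv 𝕜 wY V (C g) u‖ ≤ Bc * Real.exp (-(κ * tdist m (id u) v)) * F)
    (hGblk : ∀ z z', ‖P z' ∘L G ∘L P z‖ ≤ A₁ * Real.exp (-(κ * tdist m z z')))
    (v : TSite d m) (f : WL2 𝕜 wB V) (F : ℝ) (hfv : ∀ x, πB x ≠ v → WL2.equiv 𝕜 wB V f x = 0) (hfF : ∀ x, ‖WL2.equiv 𝕜 wB V f x‖ ≤ F)
    (b : XB) :
    ‖WL2.equiv 𝕜 wB V (G f) b‖ ≤
      (BA + BA * BU * Bc * (BU * BA * latticeConst d ((κ - κ') / 2) * (μB / ωY)) * latticeConst d ((κ - κ') / 2) ^ 3 *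
        (1 + Bc * ((BU * Real.sqrt μB / Real.sqrt ωY) * A₁ * (BU * Real.sqrt μB / Real.sqrt ωY) * latticeConst d ((κ - κ') / 2) ^ 2 *
          (Real.sqrt μY / Real.sqrt ωY)) * latticeConst d ((κ - κ') / 2) ^ 2)) * Real.exp (-(κ' * tdist m (πB b) v)) * F := by
  haveI : Nonempty (TSite d m) := ⟨v⟩
  have hgap : 0 < (κ - κ') / 2 := by linarith
  exact local_letter_G1_of_adjoint πB (tdist m) (tdist_nonneg m) (fun u y w => tdist_triangle hm u y w) (tdist_symm hm) hP hrY A G Uop Vop C hW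
    hVadj hAadj hBA hBU hBc hA₁ hκ' hκ hωY hwY hwYμ hμB hA hU hC hGblk (fun w => torusSum_le d hm hgap w) v f F hfv hfF b

include hP hrY in
/-- **THE SAME AT CONSTANT WEIGHTS** (`w_Y ≡ c₁`, bond-block mass `≤ d_B·c₁` — on the tower's diagonal `w_B ≡ c₀`, `c₀(L^{n+1})^d = c₁`, `d_B = d` bonds per
site): the weights CANCEL and the constant is a function of the letters' constants, `d_B` and `K_d((κ−κ′)∕2)` ONLY —
`B⋆ = B_A + B_A·B_U·B_c·(B_U·B_A·K·d_B)·K³·(1 + B_c·((B_U√d_B)·A₁·(B_U√d_B)·K²)·K²)`, `K = K_d((κ−κ′)∕2)` — the form the END `exists_local_letter_G1k` chooses its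
`B` in BEFORE the height. [folklore] [cite: Balaban1985BackgroundPropagators, (3.25)–(3.26) pp.394–395, Thm 3.1 (3.42) p.397, (3.49) p.399, Thm 3.11 p.416] -/
theorem local_letter_G1_torus_const (hm : ∀ i, 1 ≤ m i)
    (hW : ∀ f, G f = A f + A (Uop ((C + C ∘L Vop ∘L G ∘L Uop ∘L C) (Vop (A f)))))
    (hVadj : ContinuousLinearMap.adjoint Uop = Vop) (hAadj : ContinuousLinearMap.adjoint A = A)
    {BA BU Bc A₁ κ κ' c₁ dB : ℝ} (hBA : 0 ≤ BA) (hBU : 0 ≤ BU) (hBc : 0 ≤ Bc) (hA₁ : 0 ≤ A₁) (hκ' : 0 ≤ κ') (hκ : κ' < κ)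
    (hc₁ : 0 < c₁) (hwY : ∀ y, wY y = c₁) (hdB : 0 ≤ dB) (hμB : ∀ u, ∑ x, (if πB x = u then wB x else 0) ≤ dB * c₁)
    (hA : ∀ (v : TSite d m) (f : WL2 𝕜 wB V) (F : ℝ), (∀ x, πB x ≠ v → WL2.equiv 𝕜 wB V f x = 0) → (∀ x, ‖WL2.equiv 𝕜 wB V f x‖ ≤ F) →
      ∀ x, ‖WL2.equiv 𝕜 wB V (A f) x‖ ≤ BA * Real.exp (-(κ * tdist m (πB x) v)) * F)
    (hU : ∀ (v : TSite d m) (g : WL2 𝕜 wY V) (F : ℝ), (∀ u, id u ≠ v → WL2.equiv 𝕜 wY V g u = 0) → (∀ u, ‖WL2.equiv 𝕜 wY V g u‖ ≤ F) →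
      ∀ x, ‖WL2.equiv 𝕜 wB V (Uop g) x‖ ≤ BU * Real.exp (-(κ * tdist m (πB x) v)) * F)
    (hC : ∀ (v : TSite d m) (g : WL2 𝕜 wY V) (F : ℝ), (∀ u, id u ≠ v → WL2.equiv 𝕜 wY V g u = 0) → (∀ u, ‖WL2.equiv 𝕜 wY V g u‖ ≤ F) →
      ∀ u, ‖WL2.equiv 𝕜 wY V (C g) u‖ ≤ Bc * Real.exp (-(κ * tdist m (id u) v)) * F)
    (hGblk : ∀ z z', ‖P z' ∘L G ∘L P z‖ ≤ A₁ * Real.exp (-(κ * tdist m z z')))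
    (v : TSite d m) (f : WL2 𝕜 wB V) (F : ℝ) (hfv : ∀ x, πB x ≠ v → WL2.equiv 𝕜 wB V f x = 0) (hfF : ∀ x, ‖WL2.equiv 𝕜 wB V f x‖ ≤ F)
    (b : XB) :
    ‖WL2.equiv 𝕜 wB V (G f) b‖ ≤
      (BA + BA * BU * Bc * (BU * BA * latticeConst d ((κ - κ') / 2) * dB) * latticeConst d ((κ - κ') / 2) ^ 3 *
        (1 + Bc * ((BU * Real.sqrt dB) * A₁ * (BU * Real.sqrt dB) * latticeConst d ((κ - κ') / 2) ^ 2 * 1) *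
          latticeConst d ((κ - κ') / 2) ^ 2)) * Real.exp (-(κ' * tdist m (πB b) v)) * F := by
  have h := local_letter_G1_torus πB hP hrY A G Uop Vop C hm hW hVadj hAadj (ωY := c₁) (μY := c₁) (μB := dB * c₁) hBA hBU hBc hA₁ hκ' hκ hc₁
    (fun y => (hwY y).ge) (fun y => (hwY y).le) hμB hA hU hC hGblk v f F hfv hfF b
  have hs : 0 < Real.sqrt c₁ := Real.sqrt_pos.2 hc₁
  have e1 : dB * c₁ / c₁ = dB := by field_simp
  have e2 : BU * Real.sqrt (dB * c₁) / Real.sqrt c₁ = BU * Real.sqrt dB := by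
    rw [Real.sqrt_mul hdB, mul_div_assoc, mul_div_assoc, div_self hs.ne', mul_one]
  have e3 : Real.sqrt c₁ / Real.sqrt c₁ = 1 := div_self hs.ne'
  rw [e1, e2, e3] at h
  exact h

end Lattice

end Literature.MathematicalPhysics.QuantumFieldTheory.Balaban1983to89.B9Eq326G1SupRowAdjoint

end
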